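import Summits.AtomisticToContinuum.Crystallization.Theorems.ChartedZeroExcessLayeredLatticeLiouvilleZG
import Literature.MathematicalPhysics.StatisticalMechanics.HcpFccEnergySeries

/-!
# Part ZH «BarlowBondChart» (lens-2 g77 rider 5; the INTERFACE of steps (L2-S)/(L2-C)/(L4), memo §6a)

The common currency of the remaining (GL) plan, TYPED: a **Barlow bond chart** of a set `C ⊆ E3` on a coordinate region `D ⊆ ℤ × ℤ × ℤ`
(sheet; in-sheet Löschian coordinates) with stacking letters `τ : ℤ → Bool` is a map `Ψ : ℤ × ℤ × ℤ → E3`, injective on `D`, into `C`,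
under which bonds (`IsBond`: `0 < dist ≤ 28/25`) are EXACTLY Barlow adjacency `BarlowAdj τ` (same sheet & `LoAdj`, or height-adjacent sheets
& `CrossAdj` with the step's letter).  ★ `isBarlowBondChart_of_chart` / `exists_isBarlowBondChart_of_isCharted`: a charted set
(`IsCharted (μS S)`) carries a GLOBAL Barlow bond chart (`D = univ`) — rider ZG's dictionary + `barlowPos_injective` [Literature].  The C-side
instance near `K` for `C = placedCrystal L′ w′ U t` (an S-ADAPTED chart, memo §6a) is step (L2-C); the extension theorem (L4-comb) is stated over
two such charts.  Defs: `BarlowAdj`, `IsBarlowBondChart`.  0 sorry; standard axioms.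
-/

noncomputable section
open scoped BigOperators Classical
open Summit.AtomisticToContinuum.Crystallization.Theorems.ChartedPlanarOrderRigidityDoor (E3 IsCharted)
open Summit.AtomisticToContinuum.Crystallization.Theorems.ChartedPlanarOrderDensityDichotomy (μS)
open Summit.AtomisticToContinuum.Crystallization.Theorems.ChartedPlanarOrderDoorLayeredOsc (mem_iff_μS_singleton_ne_zero)
open Literature.MathematicalPhysics.StatisticalMechanics (IsHaggSeq barlowPos barlowStacking barlowPos_mem barlowPos_injective)

namespace Summit.AtomisticToContinuum.Crystallization.Theorems.ChartedZeroExcessLayeredLatticeLiouville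

/-- **Barlow adjacency** on sites `(k; p)` (`k` = sheet, `p ∈ ℤ × ℤ` in-sheet) with letters `τ`: same sheet and Löschian neighbours, or
height-adjacent sheets with the lower site capping the upper one across a step of letter `τ (lower sheet)`. -/
def BarlowAdj (τ : ℤ → Bool) (x y : ℤ × ℤ × ℤ) : Prop :=
  (y.1 = x.1 ∧ LoAdj x.2 y.2) ∨ (y.1 = x.1 + 1 ∧ CrossAdj (τ x.1) x.2 y.2) ∨ (x.1 = y.1 + 1 ∧ CrossAdj (τ y.1) y.2 x.2)

/-- **Barlow bond chart** of `C` on the region `D`: `Ψ` is injective on `D`, maps `D` into `C`, and bonds of the image are exactly Barlow adjacency. -/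
def IsBarlowBondChart (C : Set E3) (D : Set (ℤ × ℤ × ℤ)) (Ψ : ℤ × ℤ × ℤ → E3) (τ : ℤ → Bool) : Prop :=
  Set.InjOn Ψ D ∧ Set.MapsTo Ψ D C ∧ ∀ x ∈ D, ∀ y ∈ D, (IsBond (Ψ x) (Ψ y) ↔ BarlowAdj τ x y)

/-- `barlowAdj_symm` (docstring added by the landing lane; see the module docstring). [formal bookkeeping] -/
theorem barlowAdj_symm {τ : ℤ → Bool} {x y : ℤ × ℤ × ℤ} (h : BarlowAdj τ x y) : BarlowAdj τ y x := by
  rcases h with ⟨h1, k, hk⟩ | ⟨h1, h2⟩ | ⟨h1, h2⟩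
  · refine Or.inl ⟨h1.symm, k + 3, ?_⟩
    rw [hk, add_assoc, loDir_add_three, add_zero]
  · exact Or.inr (Or.inr ⟨h1, h2⟩)
  · exact Or.inr (Or.inl ⟨h1, h2⟩)

/-- a chart restricts to any sub-region. -/
theorem IsBarlowBondChart.mono {C : Set E3} {D D' : Set (ℤ × ℤ × ℤ)} {Ψ : ℤ × ℤ × ℤ → E3} {τ : ℤ → Bool}
    (h : IsBarlowBondChart C D Ψ τ) (hD : D' ⊆ D) : IsBarlowBondChart C D' Ψ τ :=
  ⟨h.1.mono hD, h.2.1.mono_left hD, fun x hx y hy => h.2.2 x (hD hx) y (hD hy)⟩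

/-! ### ★ The S-side instance: a charted set carries a global Barlow bond chart -/

/-- ★ from a chart `Φ` as handed by `IsCharted` (bijective onto `S`, `dist = 1 ↔ IsBond` on the ideal stacking). -/
theorem isBarlowBondChart_of_chart {S : Set E3} {s : ℤ → ℤ} (hs : IsHaggSeq s) {Φ : E3 → E3}
    (hbij : Set.BijOn Φ (barlowStacking 1 (Real.sqrt (2 / 3)) s) S)
    (hΦ : ∀ p ∈ barlowStacking 1 (Real.sqrt (2 / 3)) s, ∀ q ∈ barlowStacking 1 (Real.sqrt (2 / 3)) s,
      (dist p q = 1 ↔ IsBond (Φ p) (Φ q))) :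
    IsBarlowBondChart S Set.univ (fun x => Φ (barlowPos 1 (Real.sqrt (2 / 3)) s x.1 x.2.1 x.2.2)) (fun k => decide (s k = 1)) := by
  have hh : Real.sqrt (2 / 3) ≠ 0 := by positivity
  refine ⟨?_, ?_, ?_⟩
  · intro x _ y _ hxy
    exact barlowPos_injective one_ne_zero hh s (hbij.injOn (barlowPos_mem _ _ _) (barlowPos_mem _ _ _) hxy)
  · intro x _
    exact hbij.mapsTo (barlowPos_mem _ _ _)
  · intro x _ y _
    simpa [BarlowAdj] using charted_bond_iff hs hΦ x.1 x.2.1 x.2.2 y.1 y.2.1 y.2.2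

/-- ★★ **A CHARTED SET IS BARLOW-BOND-CHARTED (PROVED).**  `IsCharted (μS S)` (N's binder) ⇒ a global Barlow bond chart of `S`. -/
theorem exists_isBarlowBondChart_of_isCharted {S : Set E3} (h : IsCharted (μS S)) :
    ∃ s : ℤ → ℤ, IsHaggSeq s ∧ ∃ Ψ : ℤ × ℤ × ℤ → E3, IsBarlowBondChart S Set.univ Ψ (fun k => decide (s k = 1)) := by
  obtain ⟨s, hs, Φ, hbij, hΦ⟩ := h
  have hS : {p : E3 | μS S {p} ≠ 0} = S := Set.ext fun p => mem_iff_μS_singleton_ne_zero S p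
  rw [hS] at hbij
  exact ⟨s, hs, _, isBarlowBondChart_of_chart hs hbij fun p hp q hq => hΦ p hp q hq⟩

end Summit.AtomisticToContinuum.Crystallization.Theorems.ChartedZeroExcessLayeredLatticeLiouville
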